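import Summits.BirchSwinnertonDyer.BirchSwinnertonDyer.Theorems.ClassRecordThreeEulerHalvesAtThreeCoChain
import Summits.BirchSwinnertonDyer.BirchSwinnertonDyer.Theorems.ClassRecordThreeEulerHalvesAtThreeTwistLowerOfX11a
import HarnessLib

/-!
# Crux `EulerHalvesAtThree` (item stmt-BirchSwinnertonDyer-19109; routes `ClassRecordThree` = K2@3 and
# `KolyvaginRoadThree` = KOLY) — SECOND LINE «cochain»: the crux BY NAME from `PublishedInputsThree` (item 19112)
# and EXACTLY THREE stubs {Poitou–Tate ×2 (PUB, by name), CoS₃ (OPEN, IMC-grade), X11a lower half at 3 (OPEN =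
# K2 crux 19064 read at `p = 3`)}; TL₃ is DERIVED (mult-p3 p533079). LINE ONLY (cell `bsd-stepL`, planner g33,
# 2026-08-27): the REGISTERED skeleton of the item stays `Lines/birth.lean` v3 (tam3-p1; stubs J₃-max-HL ∕ J₃-multi ×2
# ∕ TL₃ ∕ facts); this file is an ALTERNATIVE line a lead may switch to, published WITHOUT `skeleton check` (a second
# check would overwrite the registered stubs — gate lesson g32).

Source of the composition: corner3-p2 g0, p534570 `Theorems/ClassRecordThreeEulerHalvesAtThreeCoChain.lean`
(`Koly.classRecordThree_eulerHalvesAtThree_of_coStepL_of_twistLower` + KOLY twin): on the SURJECTIVE loci the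
(T2′)₃ upper bound with FULL Tamagawa depth follows from CoS₃ = the «⊇» half of the anticyclotomic BDP main
conjecture at `𝟙` on surj Heegner frames (`X11b.IMCUpperWaldspurgerOnTreeAt 3 …`, x11b3's STEP L with the inequality
REVERSED) + the facts-only control identity (p528380) — in place of {J₃ʳ, J₃⁰} of line v3, whose printed
Kolyvagin-system methods give the MAX of the local Tamagawa exponents only (tam3-p1 `…JetchevMax.lean`).
TL₃ ⟸ {Skinner 2016 Thm. C at 3, X11a lower half at 3, GZK, modularity} is mult-p3's
`Koly.twistLowerAtThree_of_thmC_of_x11aLowerHalfAtThree` (p533079; planner RULING 22 (B): TL₃ is one stub BY NAME of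
K2's crux 19064 at `p = 3`, no new route item).

HONEST FRAMING: the three `stub_*` are the ONLY sorries; `EulerHalvesAtThree_of_cochain` ∕ `…'` conclude the crux decls
of both routes BY NAME with real proofs; nothing is asserted about any curve; item 19109 stays OPEN; no census word,
tier or label moves (T7). Hardest stub: `stub_coStepLAtThree` (nothing in print at `p = 3 ∥ N`; at good ordinary
`p > 3` with (sur) it is Howard 2004 Thm. B ∕ BCK21 ∕ BCS24 ∕ BCGS23 Thm. 2 — the barrier is the Steinberg prime `3`
itself: anomalous-prime ∕ `a_p = ±1` exclusions in every printed Kolyvagin-system control argument).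

References: [JetchevSkinnerWan2017] Thm. 3.3.1, §7.4.2; [Castella2018] Thm. 2.3, Thm. 3.2; [Howard2004] Thm. B;
[BCGS2023] arXiv:2312.09301 Thm. 2; [Skinner2016PacificMC] Thm. C; [Miller2011LMS] Def. 1.1; [MilneADT2006] I Thm. 4.10.
-/

noncomputable section

open scoped Classical

namespace Summit.BirchSwinnertonDyer.BirchSwinnertonDyer.Cruxes.EulerHalvesAtThree.CoChain

open WeierstrassCurve NumberField IsDedekindDomain Field Literature.NumberTheory.EllipticCurves
  Literature.NumberTheory.EllipticCurves.ModularForms Literature.NumberTheory.GaloisCohomology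
  Literature.NumberTheory.EllipticCurves.Rank1Residual Literature.NumberTheory.EllipticCurves.Rank1Residual.Typed
  Literature.NumberTheory.QuadraticFields.Quadratic
  Summit.BirchSwinnertonDyer.Rank1Residual Summit.BirchSwinnertonDyer.Rank1Residual.X11b
  Summit.BirchSwinnertonDyer.Rank1Residual.X11b.AcSelmer
  Summit.BirchSwinnertonDyer.Rank1Residual.X11b.Three Summit.BirchSwinnertonDyer.Rank1Residual.X11b.Three.Koly

/-- **STUB (PUB, BY NAME ×2)**: Poitou–Tate duality for Selmer structures (`poitouTate_selmerStructure_duality`,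
Milne ADT I Thm. 4.10 ∕ MR04 Thm. 2.3.4; refereed, typed at `Literature/NumberTheory/GaloisCohomology/
PoitouTateSelmerStructures.lean`) and the Tate-dual form for `Ш` (`poitouTate_sha_tateDual`) — the two control facts
of p528380 not carried by `PublishedInputsThree`. [cite: MilneADT2006, Ch. I Thm. 4.10] [cite: MazurRubin2004, Thm. 2.3.4] -/
theorem stub_poitouTateFactsAtThree :
    (∀ (K : Type) [Field K] [NumberField K], poitouTate_selmerStructure_duality K) ∧
    (∀ (K : Type) [Field K] [NumberField K], poitouTate_sha_tateDual K) := by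
  sorry

/-- **STUB (OPEN, IMC-grade — the load-bearing one): CoS₃**, the «⊇» (Kolyvagin-system) half of the anticyclotomic
BDP main conjecture at the trivial character on every odd surjective Heegner frame of an X11b pair at `p = 3`, in
x11b3's S0 currency `X11b.IMCUpperWaldspurgerOnTreeAt` (verbatim the `hco` binder of p534570). Nothing in print at
`p = 3 ∥ N`. [cite: Castella2018, Thm. 3.2 (p. 9) — shape at p ∤ 6N split] [cite: BCGS2023, Thm. 2 — good ordinary p > 3] -/
theorem stub_coStepLAtThree :
    ∀ (W : WeierstrassCurve ℚ) [W.IsElliptic] [W.IsGloballyMinimal]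
      (N : ℕ) [NeZero N] (K : Type) [Field K] [NumberField K]
      (Dt : ModularParametrizationData W N) (H : HeegnerDatum N (NumberField.discr K)) (ι : K →+* ℂ)
      (P : (W.baseChange K).toAffine.Point),
      ClassX11b W 3 → Surj W 3 → W.conductorNorm ℤ = N → IsImaginaryQuadratic K →
      Odd (NumberField.discr K) → SatisfiesHeegnerHypothesis N K →
      (W.quadraticTwist (NumberField.discr K : ℚ)).entireLFunction 1 ≠ 0 →
      WeierstrassCurve.Affine.Point.map ι.toRatAlgHom P = heegnerPointComplex Dt H →
      ¬ (3 : ℤ) ∣ Dt.c → ¬ IsOfFinAddOrder P →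
      ∀ (κ : ZpExtension K 3), κ.IsAnticyclotomic →
        ∀ (γ : Field.absoluteGaloisGroup K) [Fact (κ.IsTopGenerator γ)]
          (𝔭 : HeightOneSpectrum (𝓞 K)) (h𝔭 : ((3 : ℕ) : 𝓞 K) ∈ 𝔭.asIdeal)
          (he : 𝔭.asIdeal.ramificationIdx (𝓞 ℚ) = 1) (hf : 𝔭.asIdeal.inertiaDeg (𝓞 ℚ) = 1),
          IMCUpperWaldspurgerOnTreeAt 3 κ 𝔭 γ (embAt K 3 𝔭 h𝔭 he hf) P := by
  sorry

/-- **STUB (OPEN = K2 crux 19064 `X11aLowerHalf` read at `p = 3`)**: the X11a lower half at `3`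
(`ord₃ #Ш(V)_an ≤ ord₃ #Ш(V)` for `(V,3) ∈ ClassX11a`). TL₃ follows from it (next theorem); conversely TL₃ gives it
back modulo PUB (mult-p3 `Koly.twistLowerAtThree_iff_x11aLowerHalfAtThree`). [cite: GreenbergLNM1716, Conj. 1.11 — why ¬(ram) is open]
[cite: SkinnerUrban2014, Thm. 2 — the (ram) hypothesis] -/
theorem stub_x11aLowerHalfAtThree :
    ∀ (V : WeierstrassCurve ℚ) [V.IsElliptic] [V.IsGloballyMinimal],
      ClassX11a V 3 → Typed.MissingLowerBoundAt V 3 := by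
  sorry

/-- TL₃ (line v3's `stub_twistLowerAtThree`, verbatim statement) DERIVED from `stub_x11aLowerHalfAtThree` — NOT a stub
of this line (mult-p3 p533079). [cite: Skinner2016PacificMC, Thm. C (§1)] -/
theorem twistLowerAtThree_of_stub (hmod : hasEntireLFunction_rat)
    (hGZK : rank_eq_analyticRank_of_analyticRank_le_one)
    (hSk : Skinner2016.thmC_padicValRat_bsd_rank_zero) :
    ∀ (V : WeierstrassCurve ℚ) [V.IsElliptic] [V.IsGloballyMinimal],
      V.HasMultiplicativeReductionAtPrime 3 → V.HasIrreducibleModPGaloisRep 3 →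
      V.entireLFunction 1 ≠ 0 → Finite V.sha →
      ∃ q : ℚ, V.entireLFunction 1 / (V.realPeriodRat : ℂ) = (q : ℂ) ∧
        padicValRat 3 q ≤ (padicValNat 3 V.shaOrder : ℤ) + padicValNat 3 V.tamagawaProduct -
          2 * padicValNat 3 V.torsionOrder :=
  twistLowerAtThree_of_thmC_of_x11aLowerHalfAtThree hmod hGZK hSk stub_x11aLowerHalfAtThree

/-- **Composition (K2@3)**: the crux decl `ClassRecordThree.EulerHalvesAtThree` BY NAME from `PublishedInputsThree`
(item 19112, by name) and the three stubs, through p534570 §4. -/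
theorem EulerHalvesAtThree_of_cochain
    (h : Summit.BirchSwinnertonDyer.BirchSwinnertonDyer.Theses.ClassRecordThree.PublishedInputsThree) :
    Summit.BirchSwinnertonDyer.BirchSwinnertonDyer.Theses.ClassRecordThree.EulerHalvesAtThree := by
  obtain ⟨hGZ, hKo, -, hSk, -, hGZK, hmod, hnf, hHL, hMaz, -, -, -, -, -, -, -, -, -, -⟩ := h
  obtain ⟨hPT, hPT2⟩ := stub_poitouTateFactsAtThree
  exact classRecordThree_eulerHalvesAtThree_of_coStepL_of_twistLower hGZ hKo hSk hGZK hmod hnf hHL hMaz hPT hPT2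
    stub_coStepLAtThree (twistLowerAtThree_of_stub hmod hGZK hSk)

/-- **Composition (KOLY twin)**: the shared decl `KolyvaginRoadThree.EulerHalvesAtThree` from the same inputs. -/
theorem EulerHalvesAtThree_of_cochain'
    (h : Summit.BirchSwinnertonDyer.BirchSwinnertonDyer.Theses.ClassRecordThree.PublishedInputsThree) :
    Summit.BirchSwinnertonDyer.BirchSwinnertonDyer.Theses.KolyvaginRoadThree.EulerHalvesAtThree := by
  obtain ⟨hGZ, hKo, -, hSk, -, hGZK, hmod, hnf, hHL, hMaz, -, -, -, -, -, -, -, -, -, -⟩ := h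
  obtain ⟨hPT, hPT2⟩ := stub_poitouTateFactsAtThree
  exact kolyvaginRoadThree_eulerHalvesAtThree_of_coStepL_of_twistLower hGZ hKo hSk hGZK hmod hnf hHL hMaz hPT hPT2
    stub_coStepLAtThree (twistLowerAtThree_of_stub hmod hGZK hSk)

end Summit.BirchSwinnertonDyer.BirchSwinnertonDyer.Cruxes.EulerHalvesAtThree.CoChain

end
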